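import Mathlib
import Summits.AtomisticToContinuum.Crystallization.Theorems.ThreeConeCertificateSlackRigidityPricedFloorsDefs
import Summits.AtomisticToContinuum.Crystallization.Theses.PhononSlackCertificates
import Summits.AtomisticToContinuum.Crystallization.Theorems.MinimiserShells.Negative.LoadBearing
import Summits.AtomisticToContinuum.Crystallization.Theorems.PhononSlackCertificatesNearFarGlueRGlue
import Summits.AtomisticToContinuum.Crystallization.Theorems.PhononSlackCertificatesNearFarGlueRFibre
import Literature.Probability.Process.LocallyMatches
import Literature.Probability.Process.PointStationaryLaw
import Literature.MathematicalPhysics.StatisticalMechanics.LennardJonesClusters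
import Literature.Geometry.DiscreteGeometry.TwoShellPatterns
import HarnessLib

/-!
# `SlackRigidity` (stmt-AtomisticToContinuum-11960), line `priced-floors-palm-exactification`:
# stub `stub_floorsApplication` (S1 energetics)

The energetic step of the line.  GIVEN the two priced finite-volume inequalities of route
`PhononSlackCertificates` — `CoerciveTwoShellGap` (item 13956: `N e* + g #{1/20-bad} ≤ 𝓔(x)`) and
`NearFieldConvexity` (item 13958: on a set `Ω` of good particles,
`c #{i ∈ Ω not η-layered} − C #{i ∈ Ω with a particle outside Ω within 4} ≤ Σ_{i∈Ω} (½eᵢ − e*)`) —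
and the conclusion `ClusterSelectionFor δ G` of the cluster-selection engine for every measurable
event `G` of positive failure probability, every measurable event `G` containing the
`η`-layered-root event `{μ rooted δ-hard-core, LayeredAt 2 2 η (atoms μ) 0}` has `P Gᶜ = 0`.

Proof.  Suppose `P Gᶜ ≠ 0`; the selection gives `b > 0`.  Take `g` from 13956 at `δ`, `(c, C)`
from 13958 at `(δ, η)`, the packing constant `K = (2·4/δ+1)³`, the site floor
`L = (125/6) δ⁻⁶ + |e*|` (`½eᵢ ≥ −(125/6)δ⁻⁶` by `V_LJ(r) ≥ −r⁻⁶/6` and the shell sum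
`Σ_k |xᵢ−x_k|⁻⁶ ≤ 250 δ⁻⁶`), `M = c + |C| K + L` and the slack `τ = (c b / 2)/(1 + M/g)`.  The
selection at `(R, η, M) = (2, τ, 1)` produces a `δ`-separated `S ⊇ T`, `#T ≥ 1`,
`𝓔(T) ≤ #T e* + τ #T` and `≥ b #T` points `y ∈ T`, `2`-deep (`S ∩ B̄(y,2) ⊆ T`) with
`θ_y(count|S) ∉ G`; as `θ_y(count|S)` is rooted `δ`-hard-core, `¬ LayeredAt 2 2 η S y`, and by
deepness (locality of `LayeredAt` in the `S`-side radius) `¬ LayeredAt 2 2 η T y`, i.e. the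
particle fails the layered clause of 13958 (bridge `layeredAt_range_of_clause`).  With `B` the bad
and `Ω` the good particles of the `Fin #T`-indexed cluster: 13956 and the energy bound give
`g #B ≤ τ #T`; double counting `Σ_Ω + Σ_B = 𝓔 − #T e*` and the site floor give
`Σ_Ω ≤ τ #T + L #B`; the `4`-boundary of `Ω` has at most `K #B` particles (fibre count
`stub_fibre`); the deep non-layered particles number `≤ #{Ω, non-layered} + #B`.  Hence
`c b #T ≤ τ #T + M #B ≤ τ (1 + M/g) #T`, i.e. `c b ≤ c b / 2`, absurd.  All `[folklore]`
bookkeeping; the two inequalities and the selection are hypotheses.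
-/

noncomputable section

open MeasureTheory Filter Set
open scoped ENNReal BigOperators Topology

namespace Summit.AtomisticToContinuum.Crystallization.Theorems.SlackRigidityPricedFloorsApplication

open Literature.Probability.Process
open Literature.MathematicalPhysics.StatisticalMechanics
open Literature.Geometry.DiscreteGeometry
open Summit.AtomisticToContinuum.Crystallization.Theses.PhononSlackCertificates
  (CoerciveTwoShellGap NearFieldConvexity)
open Summit.AtomisticToContinuum.Crystallization.Theorems.MinimiserShells.Negative.LoadBearing (eStar)
open Summit.AtomisticToContinuum.Crystallization.Theorems.SlackRigidityPricedFloors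
open Summit.AtomisticToContinuum.Crystallization.Theorems.PhononSlackCertificatesNearFarGlueR
  (glue_sum_univ_half_site_sub stub_fibre)

/-! ## Counting helpers -/

/-- Monotonicity of `Nat.card` of subtypes under implication. [folklore] -/
theorem natCard_mono {α : Type*} [Finite α] {p q : α → Prop} (h : ∀ a, p a → q a) :
    Nat.card {a // p a} ≤ Nat.card {a // q a} :=
  Nat.card_le_card_of_injective (fun a => (⟨a.1, h a.1 a.2⟩ : {a // q a})) fun a b hab => by
    have h' := congrArg Subtype.val hab
    exact Subtype.ext h'

/-- Subadditivity of `Nat.card` of subtypes under a pointwise cover `p → q ∨ r`. [folklore] -/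
theorem natCard_le_add {α : Type*} [Fintype α] {p q r : α → Prop} (h : ∀ a, p a → q a ∨ r a) :
    Nat.card {a // p a} ≤ Nat.card {a // q a} + Nat.card {a // r a} := by
  classical
  rw [Nat.subtype_card (Finset.univ.filter p) Finset.mem_filter_univ,
    Nat.subtype_card (Finset.univ.filter q) Finset.mem_filter_univ,
    Nat.subtype_card (Finset.univ.filter r) Finset.mem_filter_univ]
  calc (Finset.univ.filter p).card
      ≤ (Finset.univ.filter q ∪ Finset.univ.filter r).card := by
        refine Finset.card_le_card fun a ha => ?_
        simp only [Finset.mem_union, Finset.mem_filter, Finset.mem_univ, true_and] at ha ⊢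
        exact h a ha
    _ ≤ (Finset.univ.filter q).card + (Finset.univ.filter r).card := Finset.card_union_le _ _

/-! ## Geometry of `LayeredAt` -/

/-- **Locality of `LayeredAt` in the `S`-side radius**: if `T ⊆ S` and `S ∩ B̄(y, ρ₁) ⊆ T`, then
`LayeredAt ρ₁ ρ₂ η T y → LayeredAt ρ₁ ρ₂ η S y`. [folklore] -/
theorem layeredAt_of_local {ρ₁ ρ₂ η : ℝ} {S T : Set E3} {y : E3} (h : LayeredAt ρ₁ ρ₂ η T y)
    (hTS : T ⊆ S) (hST : S ∩ Metric.closedBall y ρ₁ ⊆ T) : LayeredAt ρ₁ ρ₂ η S y := by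
  obtain ⟨A, t, a, s, z, hadm, hS, hL⟩ := h
  refine ⟨A, t, a, s, z, hadm,
    fun x hx hd => hS x (hST ⟨hx, Metric.mem_closedBall.2 hd⟩) hd, fun p hp hd => ?_⟩
  obtain ⟨x, hx, hxd⟩ := hL p hp hd
  exact ⟨x, hTS hx, hxd⟩

/-- **Bridge to item 13958**: the inline layered clause of `NearFieldConvexity` at particle `i` of
`x : Fin N → ℝ³` (verbatim) implies `LayeredAt 2 2 η (range x) (x i)`. [folklore] -/
theorem layeredAt_range_of_clause {N : ℕ} (x : Fin N → E3) (i : Fin N) {η : ℝ}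
    (h : ∃ (A : EuclideanSpace ℝ (Fin 3) →ₗᵢ[ℝ] EuclideanSpace ℝ (Fin 3)) (t : EuclideanSpace ℝ (Fin 3)) (a : ℝ) (s : ℤ → ℤ) (z : ℤ → ℝ), 47 / 50 ≤ a ∧ a ≤ 1 ∧ Literature.MathematicalPhysics.StatisticalMechanics.IsHaggSeq s ∧ (∀ m : ℤ, 39 / 50 * a ≤ z (m + 1) - z m ∧ z (m + 1) - z m ≤ 17 / 20 * a) ∧ let S : Set (EuclideanSpace ℝ (Fin 3)) := {p | ∃ m i j : ℤ, p = A (((i : ℝ) • Literature.MathematicalPhysics.StatisticalMechanics.triangularVec₁ a) + ((j : ℝ) • Literature.MathematicalPhysics.StatisticalMechanics.triangularVec₂ a) + ((Literature.MathematicalPhysics.StatisticalMechanics.haggLabel s m : ℝ) • Literature.MathematicalPhysics.StatisticalMechanics.barlowOffset a) + (z m • Literature.MathematicalPhysics.StatisticalMechanics.layerNormal 1))}; (∀ j : Fin N, dist (x j) (x i) ≤ 2 → ∃ p ∈ S, dist (x j + t) p ≤ η) ∧ (∀ p ∈ S, dist p (x i + t) ≤ 2 → ∃ j : Fin N, dist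 (x j + t) p ≤ η)) :
    LayeredAt 2 2 η (Set.range x) (x i) := by
  obtain ⟨A, t, a, s, z, h1, h2, h3, h4, h5⟩ := h
  obtain ⟨hS, hL⟩ := h5
  refine ⟨A, t, a, s, z, ⟨h1, h2, h3, h4⟩, ?_, fun p hp hd => ?_⟩
  · rintro _ ⟨j, rfl⟩ hd
    exact hS j hd
  · obtain ⟨j, hj⟩ := hL p hp hd
    exact ⟨x j, ⟨j, rfl⟩, hj⟩

/-- **Re-rooting a separated counting configuration at one of its points** gives a rooted
`δ`-hard-core configuration. [folklore] -/
theorem isRootedHardCore_reroot {δ : ℝ} {S : Set E3}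
    (hsep : ∀ x ∈ S, ∀ y ∈ S, x ≠ y → δ ≤ dist x y) {y : E3} (hy : y ∈ S) :
    IsRootedHardCore δ (((Measure.count : Measure E3).restrict S).map (fun z => z - y)) := by
  refine ⟨(fun z => z - y) '' S, ⟨y, hy, sub_self y⟩, ?_, map_sub_count_restrict S y⟩
  rintro _ ⟨x, hx, rfl⟩ _ ⟨x', hx', rfl⟩ hne
  rw [dist_sub_right]
  exact hsep x hx x' hx' fun hxx' => hne (by rw [hxx'])

/-! ## Energetics -/

/-- **Site floor**: in a `δ`-separated configuration `½ Σ_{j ≠ i} V_LJ(|xᵢ − xⱼ|) ≥ −(125/6) δ⁻⁶`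
(`V_LJ(r) ≥ −r⁻⁶/6` and the shell sum `sum_inv_pow_six_le`). [folklore] -/
theorem half_site_ge {N : ℕ} (x : Fin N → E3) {δ : ℝ} (hδ : 0 < δ)
    (hsep : ∀ i j : Fin N, i ≠ j → δ ≤ dist (x i) (x j)) (i : Fin N) :
    -(125 / 6 * δ⁻¹ ^ 6) ≤
      (1 / 2 : ℝ) * (∑ j ∈ Finset.univ.erase i, lennardJones (dist (x i) (x j))) := by
  have h1 : ∑ j ∈ Finset.univ.erase i, -((1 / 6 : ℝ) * (dist (x i) (x j))⁻¹ ^ 6) ≤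
      ∑ j ∈ Finset.univ.erase i, lennardJones (dist (x i) (x j)) :=
    Finset.sum_le_sum fun j hj =>
      neg_le_lennardJones_of_le (hδ.trans_le (hsep i j (Finset.ne_of_mem_erase hj).symm)) le_rfl
  have h2 : ∑ j ∈ Finset.univ.erase i, -((1 / 6 : ℝ) * (dist (x i) (x j))⁻¹ ^ 6) =
      -((1 / 6 : ℝ) * ∑ j ∈ Finset.univ.erase i, (dist (x i) (x j))⁻¹ ^ 6) := by
    rw [Finset.mul_sum, Finset.sum_neg_distrib]
  have h3 := sum_inv_pow_six_le x hδ hsep i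
  rw [h2] at h1
  linarith

/-- Item 13956 with `e*` written as `eStar` (definitional). [folklore] -/
theorem coercive_eStar (h : CoerciveTwoShellGap) {δ : ℝ} (hδ : 0 < δ) :
    ∃ g : ℝ, 0 < g ∧ ∀ (N : ℕ) (x : Fin N → E3), (∀ i j : Fin N, i ≠ j → δ ≤ dist (x i) (x j)) →
      (N : ℝ) * eStar + g * (Nat.card {i : Fin N // ¬ IsTwoShellGood (1 / 20) (47 / 50) 1 x i} : ℝ) ≤
        interactionEnergy lennardJones x :=
  h δ hδ

/-- Item 13958 with the inline layered clause replaced by `LayeredAt 2 2 η (range x) (x i)`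
(fewer non-layered particles are charged, `c > 0`) and `e*` written as `eStar`. [folklore] -/
theorem convexity_layered (h : NearFieldConvexity) {δ : ℝ} (hδ : 0 < δ) {η : ℝ} (hη : 0 < η) :
    ∃ c : ℝ, 0 < c ∧ ∃ C : ℝ, ∀ (N : ℕ) (x : Fin N → E3),
      (∀ i j : Fin N, i ≠ j → δ ≤ dist (x i) (x j)) →
      ∀ Ω : Finset (Fin N), (∀ i ∈ Ω, IsTwoShellGood (1 / 20) (47 / 50) 1 x i) →
      c * (Nat.card {i : Fin N // i ∈ Ω ∧ ¬ LayeredAt 2 2 η (Set.range x) (x i)} : ℝ) -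
        C * (Nat.card {i : Fin N // i ∈ Ω ∧ ∃ j : Fin N, j ∉ Ω ∧ dist (x j) (x i) ≤ 4} : ℝ) ≤
        ∑ i ∈ Ω, ((1 / 2 : ℝ) * (∑ j ∈ Finset.univ.erase i, lennardJones (dist (x i) (x j))) -
          eStar) := by
  obtain ⟨c, hc, C, h'⟩ := h δ hδ η hη
  refine ⟨c, hc, C, fun N x hsep Ω hΩ => ?_⟩
  refine le_trans (sub_le_sub_right (mul_le_mul_of_nonneg_left ?_ hc.le) _) (h' N x hsep Ω hΩ)
  exact Nat.cast_le.2 (natCard_mono fun i hi =>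
    ⟨hi.1, fun hcl => hi.2 (layeredAt_range_of_clause x i hcl)⟩)

/-- **Deterministic core**: the bookkeeping on one selected cluster.  From 13956 (`h56`), the
layered form of 13958 (`h58`), a `δ`-separated `S ⊇ T` with `#T ≥ 1`, `𝓔(T) ≤ #T e* + τ #T` and
`≥ b #T` points of `T` that are `2`-deep and not `η`-layered in `S`:
`c b ≤ τ (1 + M/g)` whenever `M ≥ c + |C| K + L`, `K ≥ (2·4/δ+1)³`, `L ≥ (125/6)δ⁻⁶ + |e*|`.
[folklore] -/
theorem core {δ η g c C b τ K L M : ℝ} (hδ : 0 < δ) (hg : 0 < g) (hc : 0 < c)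
    (h56 : ∀ (N : ℕ) (x : Fin N → E3), (∀ i j : Fin N, i ≠ j → δ ≤ dist (x i) (x j)) →
      (N : ℝ) * eStar + g * (Nat.card {i : Fin N // ¬ IsTwoShellGood (1 / 20) (47 / 50) 1 x i} : ℝ) ≤
        interactionEnergy lennardJones x)
    (h58 : ∀ (N : ℕ) (x : Fin N → E3), (∀ i j : Fin N, i ≠ j → δ ≤ dist (x i) (x j)) →
      ∀ Ω : Finset (Fin N), (∀ i ∈ Ω, IsTwoShellGood (1 / 20) (47 / 50) 1 x i) →
      c * (Nat.card {i : Fin N // i ∈ Ω ∧ ¬ LayeredAt 2 2 η (Set.range x) (x i)} : ℝ) -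
        C * (Nat.card {i : Fin N // i ∈ Ω ∧ ∃ j : Fin N, j ∉ Ω ∧ dist (x j) (x i) ≤ 4} : ℝ) ≤
        ∑ i ∈ Ω, ((1 / 2 : ℝ) * (∑ j ∈ Finset.univ.erase i, lennardJones (dist (x i) (x j))) -
          eStar))
    (hK : (2 * 4 / δ + 1) ^ 3 ≤ K) (hL : 125 / 6 * δ⁻¹ ^ 6 + |eStar| ≤ L) (hM : c + |C| * K + L ≤ M)
    {S : Set E3} {T : Finset E3} (hsep : ∀ x ∈ S, ∀ y ∈ S, x ≠ y → δ ≤ dist x y)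
    (hTS : (↑T : Set E3) ⊆ S) (hT1 : 1 ≤ T.card)
    (hE : interactionEnergy lennardJones (fun i : Fin T.card => ((T.equivFin.symm i : T) : E3)) ≤
      (T.card : ℝ) * eStar + τ * T.card)
    (hD : b * T.card ≤ (Nat.card {y : T // S ∩ Metric.closedBall (y : E3) 2 ⊆ ↑T ∧
      ¬ LayeredAt 2 2 η S y} : ℝ)) :
    c * b ≤ τ * (1 + M / g) := by
  classical
  -- the `Fin #T`-indexing of the cluster
  set x : Fin T.card → E3 := fun i => ((T.equivFin.symm i : T) : E3) with hx
  have hxi : ∀ i, x i = ((T.equivFin.symm i : T) : E3) := fun i => by rw [hx]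
  have hxT : ∀ i, x i ∈ T := fun i => by rw [hxi]; exact (T.equivFin.symm i).2
  have hxS : ∀ i, x i ∈ S := fun i => hTS (hxT i)
  have hxe : ∀ y : T, x (T.equivFin y) = y := fun y => by rw [hxi, Equiv.symm_apply_apply]
  have hrange : Set.range x = ↑T := by
    ext p
    constructor
    · rintro ⟨i, rfl⟩
      exact hxT i
    · intro hp
      exact ⟨T.equivFin ⟨p, hp⟩, hxe ⟨p, hp⟩⟩
  have hsepx : ∀ i j : Fin T.card, i ≠ j → δ ≤ dist (x i) (x j) := fun i j hij =>
    hsep _ (hxS i) _ (hxS j) fun h => hij (T.equivFin.symm.injective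
      (Subtype.ext ((hxi i).symm.trans (h.trans (hxi j)))))
  -- populations: good `Ω`, bad `B`
  obtain ⟨Ω, hΩ⟩ : ∃ Ω : Finset (Fin T.card),
      Ω = Finset.univ.filter fun i => IsTwoShellGood (1 / 20) (47 / 50) 1 x i := ⟨_, rfl⟩
  obtain ⟨B, hB⟩ : ∃ B : Finset (Fin T.card),
      B = Finset.univ.filter fun i => ¬ IsTwoShellGood (1 / 20) (47 / 50) 1 x i := ⟨_, rfl⟩
  have hmemΩ : ∀ i, i ∈ Ω ↔ IsTwoShellGood (1 / 20) (47 / 50) 1 x i := fun i => by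
    rw [hΩ]; exact Finset.mem_filter_univ i
  have hmemB : ∀ i, i ∈ B ↔ ¬ IsTwoShellGood (1 / 20) (47 / 50) 1 x i := fun i => by
    rw [hB]; exact Finset.mem_filter_univ i
  have hcardB : Nat.card {i : Fin T.card // ¬ IsTwoShellGood (1 / 20) (47 / 50) 1 x i} = B.card :=
    Nat.subtype_card B hmemB
  -- the two priced inequalities on the cluster
  have h1 := h56 T.card x hsepx
  rw [hcardB] at h1
  have h2 := h58 T.card x hsepx Ω fun i hi => (hmemΩ i).1 hi
  -- (i) few bad particles
  have hnB : g * (B.card : ℝ) ≤ τ * T.card := by linarith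
  -- (ii) the good particles carry little excess energy
  have hsplit : (∑ i ∈ Ω, ((1 / 2 : ℝ) * (∑ j ∈ Finset.univ.erase i, lennardJones (dist (x i) (x j)))
        - eStar)) +
      ∑ i ∈ B, ((1 / 2 : ℝ) * (∑ j ∈ Finset.univ.erase i, lennardJones (dist (x i) (x j))) - eStar) =
      interactionEnergy lennardJones x - T.card * eStar := by
    rw [← glue_sum_univ_half_site_sub x eStar, hΩ, hB]
    exact Finset.sum_filter_add_sum_filter_not _ _ _
  have hfloor : ∀ i ∈ B,
      -L ≤ (1 / 2 : ℝ) * (∑ j ∈ Finset.univ.erase i, lennardJones (dist (x i) (x j))) - eStar := by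
    intro i _
    have h := half_site_ge x hδ hsepx i
    linarith [le_abs_self eStar]
  have hSumB : (B.card : ℝ) * (-L) ≤
      ∑ i ∈ B, ((1 / 2 : ℝ) * (∑ j ∈ Finset.univ.erase i, lennardJones (dist (x i) (x j))) - eStar) := by
    have := Finset.card_nsmul_le_sum B _ _ hfloor
    rwa [nsmul_eq_mul] at this
  have hSumΩ : ∑ i ∈ Ω, ((1 / 2 : ℝ) * (∑ j ∈ Finset.univ.erase i, lennardJones (dist (x i) (x j)))
      - eStar) ≤ τ * T.card + L * B.card := by linarith
  -- (iii) the `4`-boundary of `Ω` is charged to the bad particles (fibre count)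
  have hbd : (Nat.card {i : Fin T.card // i ∈ Ω ∧ ∃ j : Fin T.card, j ∉ Ω ∧ dist (x j) (x i) ≤ 4} : ℝ)
      ≤ K * B.card := by
    obtain ⟨SB, hSB⟩ : ∃ SB : Finset (Fin T.card), SB = Finset.univ.filter fun i =>
        i ∈ Ω ∧ ∃ j : Fin T.card, j ∉ Ω ∧ dist (x j) (x i) ≤ 4 := ⟨_, rfl⟩
    have hmemSB : ∀ i, i ∈ SB ↔ (i ∈ Ω ∧ ∃ j : Fin T.card, j ∉ Ω ∧ dist (x j) (x i) ≤ 4) :=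
      fun i => by rw [hSB]; exact Finset.mem_filter_univ i
    rw [Nat.subtype_card SB hmemSB]
    refine (stub_fibre δ 4 hδ (by norm_num) T.card x hsepx SB B fun i hi => ?_).trans
      (mul_le_mul_of_nonneg_right hK (Nat.cast_nonneg _))
    obtain ⟨-, j, hj, hji⟩ := (hmemSB i).1 hi
    exact ⟨j, (hmemB j).2 fun hgj => hj ((hmemΩ j).2 hgj), (dist_comm (x i) (x j)).trans_le hji⟩
  have hCn : C * (Nat.card {i : Fin T.card // i ∈ Ω ∧ ∃ j : Fin T.card, j ∉ Ω ∧
      dist (x j) (x i) ≤ 4} : ℝ) ≤ |C| * (K * B.card) :=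
    (mul_le_mul_of_nonneg_right (le_abs_self C) (Nat.cast_nonneg _)).trans
      (mul_le_mul_of_nonneg_left hbd (abs_nonneg C))
  -- (iv) the deep non-layered particles are non-layered good particles or bad particles
  have hv : Nat.card {i : Fin T.card // S ∩ Metric.closedBall (x i) 2 ⊆ ↑T ∧ ¬ LayeredAt 2 2 η S (x i)}
      ≤ Nat.card {i : Fin T.card // i ∈ Ω ∧ ¬ LayeredAt 2 2 η (Set.range x) (x i)} +
        Nat.card {i : Fin T.card // ¬ IsTwoShellGood (1 / 20) (47 / 50) 1 x i} := by
    refine natCard_le_add fun i hi => ?_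
    by_cases hgi : IsTwoShellGood (1 / 20) (47 / 50) 1 x i
    · refine Or.inl ⟨(hmemΩ i).2 hgi, fun hl => hi.2 ?_⟩
      exact layeredAt_of_local hl (by rw [hrange]; exact hTS) (by rw [hrange]; exact hi.1)
    · exact Or.inr hgi
  rw [hcardB] at hv
  have hvR : (Nat.card {i : Fin T.card // S ∩ Metric.closedBall (x i) 2 ⊆ ↑T ∧
      ¬ LayeredAt 2 2 η S (x i)} : ℝ) ≤
      (Nat.card {i : Fin T.card // i ∈ Ω ∧ ¬ LayeredAt 2 2 η (Set.range x) (x i)} : ℝ) + B.card := by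
    exact_mod_cast hv
  -- (v) the deep non-layered points of `T`, re-indexed
  have hvi : Nat.card {y : T // S ∩ Metric.closedBall (y : E3) 2 ⊆ ↑T ∧ ¬ LayeredAt 2 2 η S y} =
      Nat.card {i : Fin T.card // S ∩ Metric.closedBall (x i) 2 ⊆ ↑T ∧ ¬ LayeredAt 2 2 η S (x i)} :=
    Nat.card_congr (Equiv.subtypeEquiv T.equivFin fun y => by rw [hxe y])
  rw [hvi] at hD
  -- bookkeeping
  have hK0 : 0 ≤ K := le_trans (by positivity) hK
  have hL0 : 0 ≤ L := le_trans (by positivity) hL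
  have hM0 : 0 ≤ M := le_trans (add_nonneg (add_nonneg hc.le (mul_nonneg (abs_nonneg C) hK0)) hL0) hM
  have hmain : c * b * T.card ≤ τ * T.card + M * B.card := by
    have e1 := mul_le_mul_of_nonneg_left hD hc.le
    have e2 := mul_le_mul_of_nonneg_left hvR hc.le
    have e3 : (c + |C| * K + L) * (B.card : ℝ) ≤ M * B.card :=
      mul_le_mul_of_nonneg_right hM (Nat.cast_nonneg _)
    nlinarith [e1, e2, e3, h2, hCn, hSumΩ]
  have hMB : M * (B.card : ℝ) ≤ M * (τ * T.card / g) := by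
    refine mul_le_mul_of_nonneg_left ?_ hM0
    rw [le_div_iff₀ hg]
    linarith
  have hT0 : (0 : ℝ) < T.card := by exact_mod_cast hT1
  have hfin : c * b * T.card ≤ τ * (1 + M / g) * T.card := by
    have e : τ * (1 + M / g) * T.card = τ * T.card + M * (τ * T.card / g) := by ring
    rw [e]
    linarith
  exact le_of_mul_le_mul_right hfin hT0

/-! ## The registered stub -/

/-- **Registered stub `stub_floorsApplication`** (S1 energetics of line
`priced-floors-palm-exactification`, crux `SlackRigidity`): given items 13956 and 13958, the
cluster selection for every measurable event of positive failure probability, and a measurable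
event `G` containing the `η`-layered-root event, `P Gᶜ = 0`. [folklore] -/
theorem stub_floorsApplication : CoerciveTwoShellGap → NearFieldConvexity → ∀ δ : ℝ, 0 < δ → ∀ P : Measure (Measure E3), IsProbabilityMeasure P → IsMinimisingLaw δ P → (∀ G : Set (Measure E3), MeasurableSet G → P Gᶜ ≠ 0 → ClusterSelectionFor δ G) → ∀ η : ℝ, 0 < η → ∀ G : Set (Measure E3), MeasurableSet G → (∀ μ : Measure E3, IsRootedHardCore δ μ → LayeredAt 2 2 η (atoms μ) 0 → μ ∈ G) → P Gᶜ = 0 := by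
  intro h56 h58 δ hδ P _ _ hsel η hη G hG hGL
  by_contra hne
  obtain ⟨b, hb, hS⟩ := hsel G hG hne
  obtain ⟨g, hg, h56'⟩ := coercive_eStar h56 hδ
  obtain ⟨c, hc, C, h58'⟩ := convexity_layered h58 hδ hη
  -- the constants and the slack
  obtain ⟨M, hM0, hMdef⟩ : ∃ M : ℝ, 0 ≤ M ∧
      M = c + |C| * (2 * 4 / δ + 1) ^ 3 + (125 / 6 * δ⁻¹ ^ 6 + |eStar|) :=
    ⟨_, by positivity, rfl⟩
  have hden : 0 < 1 + M / g := by positivity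
  obtain ⟨τ, hτ0, hτdef⟩ : ∃ τ : ℝ, 0 < τ ∧ τ = c * b / 2 / (1 + M / g) :=
    ⟨_, by positivity, rfl⟩
  -- the selected cluster
  obtain ⟨S, T, hsep, hTS, hT1, hE, hD⟩ := hS 2 τ 1 hτ0
  -- a deep point whose re-rooted configuration misses `G` is not `η`-layered in `S`
  have hD' : b * T.card ≤ (Nat.card {y : T // S ∩ Metric.closedBall (y : E3) 2 ⊆ ↑T ∧
      ¬ LayeredAt 2 2 η S y} : ℝ) := by
    refine hD.trans ?_
    exact Nat.cast_le.2 (natCard_mono fun y hy => ⟨hy.1, fun hl => hy.2 (hGL _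
      (isRootedHardCore_reroot hsep (hTS y.2))
      ((layeredAt_atoms_map_sub_iff 2 2 η _ (y : E3)).2 (by rw [atoms_count_restrict]; exact hl)))⟩)
  have key := core hδ hg hc h56' h58' le_rfl le_rfl hMdef.ge hsep hTS hT1 hE hD'
  rw [hτdef, div_mul_cancel₀ _ hden.ne'] at key
  linarith [mul_pos hc hb]

end Summit.AtomisticToContinuum.Crystallization.Theorems.SlackRigidityPricedFloorsApplication

end
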